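/-
Copyright (c) 2026 the pub-hodgecm-mathlib formalisation cell (harness21).  Prover seat hodgecm-mathlib-K2E4-p11 (g7), Track B ∕ K2-LIT, h413 = `stmt-HodgeConjecture-24833`,
ENGINE E1, 5Res campaign «ENDGAME BY FAMILIES», AMENDMENT #3 «GENERAL (U,τ) LADDER» rung G11, deal (282) of K2E1-plan (g7): the LETTERS of the `K_∞`-TYPE (scalar `τ`) EDITION of
K2E4-p23's RUNG-1 skeleton — generic `τ`-top in `L²` currency, `hPfix ∕ hEisdef ∕ hD5` at `χ = τ⁻¹`, and the `τ = 1` currency bridges; consumed by `K2E1ResidualKTypeFiniteOfTwoBlockFamilies`.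
-/
import Summits.HodgeConjecture.HodgeConjecture.Theorems.K2E1ResidualSphericalFiniteOfTwoBlockFamilies   -- ★ (K2E4-p23): brings ★ p860902∕p860686 (`lpModel_blockProj_eq_zero_letterFree_two`)∕p860649 (`cm_blockProjector_hPfix`)∕p860688∕p860758∕p860792 and the CM frame
import Summits.HodgeConjecture.HodgeConjecture.Theorems.K2E1BlockProjectorRangeU                          -- ★ p860843 (K2E2-p12): `cm_kType_eigen_of_blockProjector_eq_self`, `cm_level_invariant_of_blockProjector_eq_self`
import HarnessLib

/-!
# K2·E1 — `K2E1ResidualKTypeAtomLettersCMTwo`: THE LETTERS OF RUNG 1 AT A SCALAR `K_∞`-TYPE `τ` — generic `τ`-top, `hPfix ∕ hEisdef ∕ hD5` at `χ = τ⁻¹`, and the `τ = 1` bridges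
# (G11 skeleton τ-edition, deal (282), part 1 of 2; part 2 = `K2E1ResidualKTypeFiniteOfTwoBlockFamilies`)

Track B ∕ K2-LIT, crux h413 = `stmt-HodgeConjecture-24833`, route of record `HCCMUnconditional`; cell `hodgecm-mathlib`, squad K2, ENGINE E1 (5Res, AMENDMENT #3 G11); dealer
K2E1-plan (g7) (282): «`K2E1ResidualKTypeFiniteOfTwoBlockFamilies` = K2E4-p23's TwoBlockFamilies §3 with `invariants Kad ↦ (K′_f-invariants) ⊓ ⨅_{k : K_∞} eigenspace (R (ι_∞ k)) (τ k)`
(scalar `K_∞`-type `τ : K_∞ →* ℂ` first), hypothesis-first on `hEis_τ` ∕ packages, in-file witness at `τ = 1` recovering p23's head» — this file holds the LETTERS.  THEOREMS ONLY (no `def`,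
no `instance`, no notation, no named-fact hypothesis, no `sorry`; default heartbeats except the MEASURED scoped `set_option maxHeartbeats 400000 in` lines marked R36); lane `--supports stmt-HodgeConjecture-24833 --as helper` (count-neutral).  CLOSES NO SOCKET.

SETTING (K2E2-p12's frame, as ★ p23).  `G = U(J)` over the CM extension `L∕L⁺`, `N = 2`; `K_∞ := U(J)(L⁺ ⊗ ℝ) ∩ U(1 ⊗ 1)` (`ι_∞ ∘ incl`), probability Haar measure `μ_K`; an open level
`K′ ≤ G(𝔸_f)` with normalised idempotent `e`; the SCALAR `K_∞`-TYPE `τ : K_∞ →* ℂ` with `‖τ‖ = 1` (`hτ`) and the projector test function `χ = τ⁻¹` (`hχτ : χ k = (τ k)⁻¹`, ★ F1_τ's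
`(τ k)⁻¹ • π(ι k)` currency); block projector `P = P_χ ∘L R_f(e)` (`hPdef`, p23's bytes).  `τ`-ISOTYPIC EISENSTEIN SPACE (dealer's split currency):
`Eis_τ := (L²_cusp(𝔓))ᗮ ⊓ (R ∘ ι_f|_{K′})-invariants ⊓ ⨅_{k : K_∞} eigenspace (R (ι_∞ incl k)) (τ k)`.
* §1 (generic `𝒢`) **`residual_kType_finiteDimensional_of_atoms`** — atoms at `(τ, K′)` ⟹ `L²_res ⊓ (R∘ι_f|_{K′})-invariants ⊓ ⨅_k eigenspace (R (ι_a k)) (τ k)` finite-dimensional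
  (K2E4-p14's ★ `residual_invariants_finiteDimensional_of_atoms` with the eigen fix-clause; the `L²`-currency twin of ★ p860770 `eigenspace_finiteDimensional_of_atoms_at`).
* §2 (any group) the character letters of `χ = τ⁻¹`: `hχmul_of_kType ∕ hχone_of_kType ∕ hχinvk_of_kType ∕ hχinv_of_kType`.
* §3 (`U(J)(𝔸_{L⁺})`) `hPfix_kType` (★ p860649, eigen-clause `χ k⁻¹ = τ k`), `hEisdef_kType_split` (★ p860843 ×2, split currency), `hD5_letterFree_two_of_letters` (★ p860686 with the three
  character letters — p23's ★ `hD5_letterFree_two` is its `χ ≡ 1` wrapper).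
* §4 (`τ = 1` bridges for the witness) `eisOne_split_le_eis` (`Eis_1 ≤ Eis(Kad)` for `Kad ≤ closure (ι_∞ incl (K_∞) ∪ ι_f(K′))`, closure induction as in ★ p860758),
  `invariants_le_iInf_eigenspace_one`.
HONEST LABEL: HC_CM is proved only modulo the 7 printed citations (2 remaining named inputs: hLiu418 = `stmt-HodgeConjecture-24832`, h413 = `stmt-HodgeConjecture-24833`) until rung 0
closes; this file asserts no named fact, is conditional by construction on its visible binders, and closes no socket; count-neutral; RUNG 1_τ ≠ 5Res.

## References
* [MoeglinWaldspurger1995] C. Mœglin, J.-L. Waldspurger, *Spectral decomposition and Eisenstein series* (1995), I.2.18, II.2.4, IV.3.12, V.3.13, VI.2.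
* [HarishChandra1968] Harish-Chandra, *Automorphic forms on semisimple Lie groups*, LNM 62 (1968), Thm. 1.
* [BorelJacquet1979] A. Borel, H. Jacquet, PSPM 33.1 (1979), §4.1, §4.6.
* [Knapp1986] A. W. Knapp, *Representation Theory of Semisimple Groups* (1986), VIII §3.
-/

set_option autoImplicit false
-- the mandated namespace repeats the single-problem summit's segment (`HodgeConjecture.HodgeConjecture`)
set_option linter.dupNamespace false

noncomputable section

open MeasureTheory MeasureTheory.Measure Filter Topology CompactlySupported NumberField NumberField.mixedEmbedding NumberField.InfinitePlace ContRepresentation Set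
open scoped InnerProductSpace ENNReal ComplexConjugate NNReal
open Literature.NumberTheory.Automorphic Literature.NumberTheory.Automorphic.UnitaryGroup AdelicGroupData
open Summit.HodgeConjecture.HodgeConjecture.Cruxes.H413.K2E1CuspidalSpectrumUnitary
open Summit.HodgeConjecture.HodgeConjecture.Cruxes.H413.K2E1BlockProjectorFixesVectorsU (cm_blockProjector_hPfix)
open Summit.HodgeConjecture.HodgeConjecture.Cruxes.H413.K2E1BlockProjectorRangeU (cm_kType_eigen_of_blockProjector_eq_self cm_level_invariant_of_blockProjector_eq_self)
open Summit.HodgeConjecture.HodgeConjecture.Cruxes.H413.K2E1BlockHeckeTBLetterFreeCMTwo (lpModel_blockProj_eq_zero_letterFree_two)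
open Summit.HodgeConjecture.HodgeConjecture.Cruxes.H413.K2E1ResidualPartSpanIrreduciblesU (residualSubspace_eq_iSupClosure)
open Summit.HodgeConjecture.HodgeConjecture.Cruxes.H413.K2E1ResidualLevelFiniteOfAtomsU (mem_of_mem_topologicalClosure_biSup)

namespace Summit.HodgeConjecture.HodgeConjecture.Cruxes.H413.K2E1ResidualKTypeAtomLettersCMTwo

universe u

/-! ## §1 Generic `𝒢`: atoms at `(τ, K′)` ⟹ `L²_res ⊓ L²^{ι_f K′} ⊓ (L²)^{ι_a, τ}` is finite-dimensional -/

section Generic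

variable {F : Type} [Field F] [NumberField F] (𝒢 : AdelicGroupData.{u} F) (μ : Measure 𝒢.automorphicQuotient) [𝒢.IsAutomorphicMeasure μ]
  (𝔓 : 𝒢.ParabolicUnipotentData)

/-- **ATOMS AT `(τ, K′)` ⟹ THE `K′`-INVARIANT, `τ`-ISOTYPIC PART OF `L²_res` IS FINITE-DIMENSIONAL** (generic `𝒢`; the `L²`-currency twin of ★ p860770
`eigenspace_finiteDimensional_of_atoms_at`, K2E4-p14's ★ `residual_invariants_finiteDimensional_of_atoms` with the eigen fix-clause).  `hatoms₀`: `∃ P A, dim A < ∞ ∧ (P` fixes every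
`x` with `R(ι_f u) x = x` (`u ∈ K′`) and `R(ι_a k) x = τ k • x`) ∧ (P` maps every irreducible closed `W ≤ L²_res` into `A)`.  CONCLUSION:
`L²_res ⊓ (R ∘ ι_f|_{K′}).invariants ⊓ ⨅_k eigenspace (R (ι_a k)) (τ k) ≤ A` is finite-dimensional. [cite: MoeglinWaldspurger1995, I.2.18 and V.3.13] [cite: HarishChandra1968, Thm. 1] -/
theorem residual_kType_finiteDimensional_of_atoms
    {Kc : Type*} [Group Kc] (ιa : Kc →* 𝒢.Adelic) {Kf : Type*} [Group Kf] (ιf : Kf →* 𝒢.Adelic) (K' : Subgroup Kf) (τ : Kc →* ℂ)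
    (hatoms₀ : ∃ (P : 𝒢.L2 μ →L[ℂ] 𝒢.L2 μ) (A : Submodule ℂ (𝒢.L2 μ)), FiniteDimensional ℂ A ∧
      (∀ x : 𝒢.L2 μ, (∀ u ∈ K', 𝒢.rightRegular μ (ιf u) x = x) → (∀ k : Kc, 𝒢.rightRegular μ (ιa k) x = τ k • x) → P x = x) ∧
      ∀ W : ClosedSubrep (𝒢.rightRegular μ), W.toContRep.IsTopIrreducible → W ≤ residualSubspace 𝒢 μ 𝔓 → ∀ w ∈ W, P w ∈ A) :
    FiniteDimensional ℂ ↥((residualSubspace 𝒢 μ 𝔓).toSubmodule ⊓ ((𝒢.rightRegular μ).restrict (ιf.comp K'.subtype)).invariants ⊓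
      ⨅ k : Kc, Module.End.eigenspace (((𝒢.rightRegular μ) (ιa k) : 𝒢.L2 μ →L[ℂ] 𝒢.L2 μ) : 𝒢.L2 μ →ₗ[ℂ] 𝒢.L2 μ) (τ k)) := by
  obtain ⟨P, A, hAfd, hPfix, hPW⟩ := hatoms₀
  haveI := hAfd
  refine Submodule.finiteDimensional_of_le (fun x hx => ?_ :
    (residualSubspace 𝒢 μ 𝔓).toSubmodule ⊓ ((𝒢.rightRegular μ).restrict (ιf.comp K'.subtype)).invariants ⊓
      (⨅ k : Kc, Module.End.eigenspace (((𝒢.rightRegular μ) (ιa k) : 𝒢.L2 μ →L[ℂ] 𝒢.L2 μ) : 𝒢.L2 μ →ₗ[ℂ] 𝒢.L2 μ) (τ k)) ≤ A)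
  obtain ⟨hx₁, ha⟩ := Submodule.mem_inf.1 hx
  obtain ⟨hres, hf⟩ := Submodule.mem_inf.1 hx₁
  have h1 : ∀ u ∈ K', 𝒢.rightRegular μ (ιf u) x = x := fun u hu => (ContRepresentation.mem_invariants x).1 hf ⟨u, hu⟩
  have h2 : ∀ k : Kc, 𝒢.rightRegular μ (ιa k) x = τ k • x := fun k => by
    have h := (Submodule.mem_iInf _).1 ha k
    rwa [Module.End.mem_eigenspace_iff] at h
  have hPx : P x = x := hPfix x h1 h2
  -- the irreducible `W ⊥ L²_cusp` lie in `L²_res` (★ D5′-pre), so `P` maps them into `A`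
  have hPW' : ∀ W ∈ {W : ClosedSubrep (𝒢.rightRegular μ) | W.toContRep.IsTopIrreducible ∧ W ≤ (𝒢.cuspidalSubspace μ 𝔓).orthogonal (𝒢.isUnitary_rightRegular μ)},
      ∀ w ∈ W.toSubmodule, P w ∈ A := fun W hW w hw =>
    hPW W hW.1 (by rw [residualSubspace_eq_iSupClosure]; exact ClosedSubrep.le_iSupClosure hW) w hw
  have hxres : x ∈ ClosedSubrep.iSupClosure {W : ClosedSubrep (𝒢.rightRegular μ) |
      W.toContRep.IsTopIrreducible ∧ W ≤ (𝒢.cuspidalSubspace μ 𝔓).orthogonal (𝒢.isUnitary_rightRegular μ)} :=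
    (residualSubspace_eq_iSupClosure 𝒢 μ 𝔓).le hres
  exact mem_of_mem_topologicalClosure_biSup {W : ClosedSubrep (𝒢.rightRegular μ) | W.toContRep.IsTopIrreducible ∧ W ≤ (𝒢.cuspidalSubspace μ 𝔓).orthogonal (𝒢.isUnitary_rightRegular μ)}
    (fun W => W.toSubmodule) P A hPW' hxres hPx

end Generic

/-! ## §2 The character letters of `χ = τ⁻¹` (any group) -/

section Characters

variable {K : Type*} [Group K] (χ₁ : K → ℂ) (τ : K →* ℂ)

/-- `χ = τ⁻¹` is multiplicative (ℂ is commutative). [folklore] -/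
theorem hχmul_of_kType (hχτ : ∀ k, χ₁ k = (τ k)⁻¹) : ∀ k l, χ₁ (k * l) = χ₁ k * χ₁ l := fun k l => by
  rw [hχτ, hχτ, hχτ, map_mul, mul_inv]

/-- `χ = τ⁻¹` takes the value `1` at `1`. [folklore] -/
theorem hχone_of_kType (hχτ : ∀ k, χ₁ k = (τ k)⁻¹) : χ₁ 1 = 1 := by
  rw [hχτ, map_one, inv_one]

/-- `χ k⁻¹ = τ k` for `χ = τ⁻¹`: the eigen-clause of ★ `cm_blockProjector_hPfix` ∕ ★ `cm_kType_eigen_of_blockProjector_eq_self` reads `R(ι_∞ k) x = τ k • x`. [folklore] -/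
theorem hχinvk_of_kType (hχτ : ∀ k, χ₁ k = (τ k)⁻¹) : ∀ k, χ₁ k⁻¹ = τ k := fun k => by
  rw [hχτ, map_inv, inv_inv]

/-- `χ = τ⁻¹` is unitary when `‖τ‖ = 1`: `conj (χ k⁻¹) = χ k` (the third character letter of ★ `lpModel_blockProj_eq_zero_letterFree_two`). [folklore] -/
theorem hχinv_of_kType (hχτ : ∀ k, χ₁ k = (τ k)⁻¹) (hτ : ∀ k, ‖τ k‖ = 1) : ∀ k, conj (χ₁ k⁻¹) = χ₁ k := fun k => by
  rw [hχinvk_of_kType χ₁ τ hχτ k, hχτ, Complex.inv_def, Complex.normSq_eq_norm_sq, hτ k]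
  simp

end Characters

/-! ## §3 `U(J)(𝔸_{L⁺})`, K2E2-p12's frame: `hPfix`, `hEisdef` (split currency), `hD5` at a scalar `K_∞`-type -/

section CM

variable {L : Type} [Field L] [NumberField L] [IsCMField L] (J : Matrix (Fin 2) (Fin 2) L)
  (μ : Measure (cmDatum L 2 J).automorphicQuotient) [(cmDatum L 2 J).IsAutomorphicMeasure μ]
  [MeasurableSpace (UnitaryGroup.arch (↥(maximalRealSubfield L)) L (IsCMField.complexConj L) 2 J)] [BorelSpace (UnitaryGroup.arch (↥(maximalRealSubfield L)) L (IsCMField.complexConj L) 2 J)]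
  [MeasurableSpace (finAdelic (↥(maximalRealSubfield L)) L (IsCMField.complexConj L) 2 J)] [BorelSpace (finAdelic (↥(maximalRealSubfield L)) L (IsCMField.complexConj L) 2 J)]
  (νinf : Measure (UnitaryGroup.arch (↥(maximalRealSubfield L)) L (IsCMField.complexConj L) 2 J)) [IsHaarMeasure νinf] [νinf.IsInvInvariant] [SFinite νinf]
  (νf : Measure (finAdelic (↥(maximalRealSubfield L)) L (IsCMField.complexConj L) 2 J)) [IsFiniteMeasureOnCompacts νf] [νf.IsMulLeftInvariant] [νf.IsInvInvariant] [νf.IsOpenPosMeasure]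
  [MeasurableSpace ↥(UnitaryGroup.arch (↥(maximalRealSubfield L)) L (IsCMField.complexConj L) 2 J ⊓ unitaryGroupOfForm (conjMixed (↥(maximalRealSubfield L)) L (IsCMField.complexConj L)) 1)] [BorelSpace ↥(UnitaryGroup.arch (↥(maximalRealSubfield L)) L (IsCMField.complexConj L) 2 J ⊓ unitaryGroupOfForm (conjMixed (↥(maximalRealSubfield L)) L (IsCMField.complexConj L)) 1)]
  (μK : Measure ↥(UnitaryGroup.arch (↥(maximalRealSubfield L)) L (IsCMField.complexConj L) 2 J ⊓ unitaryGroupOfForm (conjMixed (↥(maximalRealSubfield L)) L (IsCMField.complexConj L)) 1)) [IsProbabilityMeasure μK] [μK.IsMulLeftInvariant] [μK.IsMulRightInvariant] [μK.IsInvInvariant]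
  (χ : C_c(↥(UnitaryGroup.arch (↥(maximalRealSubfield L)) L (IsCMField.complexConj L) 2 J ⊓ unitaryGroupOfForm (conjMixed (↥(maximalRealSubfield L)) L (IsCMField.complexConj L)) 1), ℂ)) (e : C_c(finAdelic (↥(maximalRealSubfield L)) L (IsCMField.complexConj L) 2 J, ℂ))


omit [MeasurableSpace (UnitaryGroup.arch (↥(maximalRealSubfield L)) L (IsCMField.complexConj L) 2 J)] [BorelSpace (UnitaryGroup.arch (↥(maximalRealSubfield L)) L (IsCMField.complexConj L) 2 J)] [νf.IsMulLeftInvariant] [νf.IsInvInvariant] [νf.IsOpenPosMeasure]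
  [μK.IsMulLeftInvariant] [μK.IsMulRightInvariant] [μK.IsInvInvariant] in
/-- **`hPfix` AT THE `K_∞`-TYPE `τ`** (★ p860649 with `χ = τ⁻¹`): the block projector `P = P_χ ∘L R_f(e)` fixes every vector that is `K′`-invariant under the finite factor and a
`τ`-eigenvector of `ι_∞(K_∞)` — the fix-clause of ★ `hatoms_of_noLineMass₂` with `(ιK, ιa, ιf, χ₀, U₀) := (id, ι_∞ ∘ incl, ι_f, τ, K′)`. [cite: Knapp1986, VIII §3] [cite: BorelJacquet1979, §4.1] -/
theorem hPfix_kType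
    (τ : ↥(UnitaryGroup.arch (↥(maximalRealSubfield L)) L (IsCMField.complexConj L) 2 J ⊓ unitaryGroupOfForm (conjMixed (↥(maximalRealSubfield L)) L (IsCMField.complexConj L)) 1) →* ℂ) (hχτ : ∀ k, χ k = (τ k)⁻¹)
    (K' : Subgroup (finAdelic (↥(maximalRealSubfield L)) L (IsCMField.complexConj L) 2 J)) (hK'o : IsOpen (K' : Set (finAdelic (↥(maximalRealSubfield L)) L (IsCMField.complexConj L) 2 J))) (he0 : ∀ x, x ∉ K' → e x = 0) (he1 : ∫ x, e x ∂νf = 1)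
    (P : (cmDatum L 2 J).L2 μ →L[ℂ] (cmDatum L 2 J).L2 μ) (hPdef : P = ((((cmDatum L 2 J).rightRegular μ).restrict ((archToAdelic (↥(maximalRealSubfield L)) L (IsCMField.complexConj L) 2 J).comp (Subgroup.inclusion (inf_le_left : UnitaryGroup.arch (↥(maximalRealSubfield L)) L (IsCMField.complexConj L) 2 J ⊓ unitaryGroupOfForm (conjMixed (↥(maximalRealSubfield L)) L (IsCMField.complexConj L)) 1 ≤ UnitaryGroup.arch (↥(maximalRealSubfield L)) L (IsCMField.complexConj L) 2 J)))).integratedOperator (((cmDatum L 2 J).isUnitary_rightRegular μ).restrict _)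
          (((cmDatum L 2 J).isStronglyContinuous_rightRegular_holds μ).restrict _ ((continuous_archToAdelic (↥(maximalRealSubfield L)) L (IsCMField.complexConj L) 2 J).comp (continuous_induced_rng.2 continuous_subtype_val))) μK χ ∘L
        (((cmDatum L 2 J).rightRegular μ).restrict (finAdelicToAdelic (↥(maximalRealSubfield L)) L (IsCMField.complexConj L) 2 J)).integratedOperator (((cmDatum L 2 J).isUnitary_rightRegular μ).restrict _) (((cmDatum L 2 J).isStronglyContinuous_rightRegular_holds μ).restrict _ (continuous_finAdelicToAdelic (↥(maximalRealSubfield L)) L (IsCMField.complexConj L) 2 J)) νf e)) :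
    ∀ x : (cmDatum L 2 J).L2 μ, (∀ u ∈ (⟨K', hK'o⟩ : OpenSubgroup (finAdelic (↥(maximalRealSubfield L)) L (IsCMField.complexConj L) 2 J)), ((cmDatum L 2 J).rightRegular μ) ((MonoidHom.id (cmDatum L 2 J).Adelic) ((finAdelicToAdelic (↥(maximalRealSubfield L)) L (IsCMField.complexConj L) 2 J) u)) x = x) →
      (∀ t : ↥(UnitaryGroup.arch (↥(maximalRealSubfield L)) L (IsCMField.complexConj L) 2 J ⊓ unitaryGroupOfForm (conjMixed (↥(maximalRealSubfield L)) L (IsCMField.complexConj L)) 1), ((cmDatum L 2 J).rightRegular μ) ((MonoidHom.id (cmDatum L 2 J).Adelic) (((archToAdelic (↥(maximalRealSubfield L)) L (IsCMField.complexConj L) 2 J).comp (Subgroup.inclusion (inf_le_left : UnitaryGroup.arch (↥(maximalRealSubfield L)) L (IsCMField.complexConj L) 2 J ⊓ unitaryGroupOfForm (conjMixed (↥(maximalRealSubfield L)) L (IsCMField.complexConj L)) 1 ≤ UnitaryGroup.arch (↥(maximalRealSubfield L)) L (IsCMField.complexConj L) 2 J))) t)) x = τ t • x) → P x = x := by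
  intro x hxU hxχ
  subst hPdef
  refine cm_blockProjector_hPfix ((cmDatum L 2 J).rightRegular μ) ((cmDatum L 2 J).isUnitary_rightRegular μ) ((cmDatum L 2 J).isStronglyContinuous_rightRegular_holds μ) νf (Subgroup.inclusion (inf_le_left : UnitaryGroup.arch (↥(maximalRealSubfield L)) L (IsCMField.complexConj L) 2 J ⊓ unitaryGroupOfForm (conjMixed (↥(maximalRealSubfield L)) L (IsCMField.complexConj L)) 1 ≤ UnitaryGroup.arch (↥(maximalRealSubfield L)) L (IsCMField.complexConj L) 2 J)) (continuous_induced_rng.2 continuous_subtype_val) μK χ e (hχmul_of_kType χ τ hχτ) (hχone_of_kType χ τ hχτ) K' he0 he1 x (fun u hu => hxU u hu) fun k => ?_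
  rw [hχinvk_of_kType χ τ hχτ k]
  exact hxχ k

set_option maxHeartbeats 400000 in -- measured (R36): farm-direct cost of this decl ∈ (100000, 150000] at the default 200000 (probes 100000 ✗ ∕ 150000 ✓); scoped 400000 keeps ≥ 2× off lake's cliff (BF-N26∕N27 class)
omit [MeasurableSpace (UnitaryGroup.arch (↥(maximalRealSubfield L)) L (IsCMField.complexConj L) 2 J)] [BorelSpace (UnitaryGroup.arch (↥(maximalRealSubfield L)) L (IsCMField.complexConj L) 2 J)] [νf.IsInvInvariant] [νf.IsOpenPosMeasure] [μK.IsMulRightInvariant] [μK.IsInvInvariant] in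
/-- **`hEisdef` AT THE `K_∞`-TYPE `τ`, SPLIT CURRENCY** (★ p860843 ×2): a `P`-fixed vector of `(L²_cusp)ᗮ` is `K′`-invariant under `ι_f` and a `τ`-eigenvector of `ι_∞(K_∞)`
(`χ k⁻¹ = τ k`), i.e. lies in `Eis_τ = (L²_cusp)ᗮ ⊓ (R∘ι_f|_{K′})-invariants ⊓ ⨅_k eigenspace (R (ι_∞ incl k)) (τ k)` — the letter ★ `hPEis_of_letters` consumes.
[cite: Knapp1986, VIII §3] [cite: BorelJacquet1979, §4.1] -/
theorem hEisdef_kType_split [MeasurableMul (finAdelic (↥(maximalRealSubfield L)) L (IsCMField.complexConj L) 2 J)]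
    (τ : ↥(UnitaryGroup.arch (↥(maximalRealSubfield L)) L (IsCMField.complexConj L) 2 J ⊓ unitaryGroupOfForm (conjMixed (↥(maximalRealSubfield L)) L (IsCMField.complexConj L)) 1) →* ℂ) (hχτ : ∀ k, χ k = (τ k)⁻¹)
    (K' : Subgroup (finAdelic (↥(maximalRealSubfield L)) L (IsCMField.complexConj L) 2 J)) (heK : ∀ k ∈ K', ∀ x, e (k * x) = e x)
    (P : (cmDatum L 2 J).L2 μ →L[ℂ] (cmDatum L 2 J).L2 μ) (hPdef : P = ((((cmDatum L 2 J).rightRegular μ).restrict ((archToAdelic (↥(maximalRealSubfield L)) L (IsCMField.complexConj L) 2 J).comp (Subgroup.inclusion (inf_le_left : UnitaryGroup.arch (↥(maximalRealSubfield L)) L (IsCMField.complexConj L) 2 J ⊓ unitaryGroupOfForm (conjMixed (↥(maximalRealSubfield L)) L (IsCMField.complexConj L)) 1 ≤ UnitaryGroup.arch (↥(maximalRealSubfield L)) L (IsCMField.complexConj L) 2 J)))).integratedOperator (((cmDatum L 2 J).isUnitary_rightRegular μ).restrict _)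
          (((cmDatum L 2 J).isStronglyContinuous_rightRegular_holds μ).restrict _ ((continuous_archToAdelic (↥(maximalRealSubfield L)) L (IsCMField.complexConj L) 2 J).comp (continuous_induced_rng.2 continuous_subtype_val))) μK χ ∘L
        (((cmDatum L 2 J).rightRegular μ).restrict (finAdelicToAdelic (↥(maximalRealSubfield L)) L (IsCMField.complexConj L) 2 J)).integratedOperator (((cmDatum L 2 J).isUnitary_rightRegular μ).restrict _) (((cmDatum L 2 J).isStronglyContinuous_rightRegular_holds μ).restrict _ (continuous_finAdelicToAdelic (↥(maximalRealSubfield L)) L (IsCMField.complexConj L) 2 J)) νf e))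
    (𝔓 : (cmDatum L 2 J).ParabolicUnipotentData) :
    ∀ x : (cmDatum L 2 J).L2 μ, x ∈ ((cmDatum L 2 J).cuspidalSubspace μ 𝔓).orthogonal ((cmDatum L 2 J).isUnitary_rightRegular μ) → P x = x →
      x ∈ ((cmDatum L 2 J).cuspidalSubspace μ 𝔓).toSubmoduleᗮ ⊓ (((cmDatum L 2 J).rightRegular μ).restrict ((finAdelicToAdelic (↥(maximalRealSubfield L)) L (IsCMField.complexConj L) 2 J).comp K'.subtype)).invariants ⊓ ⨅ k : ↥(UnitaryGroup.arch (↥(maximalRealSubfield L)) L (IsCMField.complexConj L) 2 J ⊓ unitaryGroupOfForm (conjMixed (↥(maximalRealSubfield L)) L (IsCMField.complexConj L)) 1), Module.End.eigenspace ((((cmDatum L 2 J).rightRegular μ) (((archToAdelic (↥(maximalRealSubfield L)) L (IsCMField.complexConj L) 2 J).comp (Subgroup.inclusion (inf_le_left : UnitaryGroup.arch (↥(maximalRealSubfield L)) L (IsCMField.complexConj L) 2 J ⊓ unitaryGroupOfForm (conjMixed (↥(maximalRealSubfield L)) L (IsCMField.complexConj L)) 1 ≤ UnitaryGroup.arch (↥(maximalRealSubfield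 L)) L (IsCMField.complexConj L) 2 J))) k) : (cmDatum L 2 J).L2 μ →L[ℂ] (cmDatum L 2 J).L2 μ) : (cmDatum L 2 J).L2 μ →ₗ[ℂ] (cmDatum L 2 J).L2 μ) (τ k) := by
  intro x hxo hPx
  subst hPdef
  refine Submodule.mem_inf.2 ⟨Submodule.mem_inf.2 ⟨hxo, ?_⟩, ?_⟩
  · rw [ContRepresentation.mem_invariants]
    intro u
    exact cm_level_invariant_of_blockProjector_eq_self ((cmDatum L 2 J).rightRegular μ) ((cmDatum L 2 J).isUnitary_rightRegular μ) ((cmDatum L 2 J).isStronglyContinuous_rightRegular_holds μ) νf (Subgroup.inclusion (inf_le_left : UnitaryGroup.arch (↥(maximalRealSubfield L)) L (IsCMField.complexConj L) 2 J ⊓ unitaryGroupOfForm (conjMixed (↥(maximalRealSubfield L)) L (IsCMField.complexConj L)) 1 ≤ UnitaryGroup.arch (↥(maximalRealSubfield L)) L (IsCMField.complexConj L) 2 J)) (continuous_induced_rng.2 continuous_subtype_val) μK χ e K' heK x hPx u.2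
  · rw [Submodule.mem_iInf]
    intro k
    rw [Module.End.mem_eigenspace_iff, ← hχinvk_of_kType χ τ hχτ k]
    exact cm_kType_eigen_of_blockProjector_eq_self ((cmDatum L 2 J).rightRegular μ) ((cmDatum L 2 J).isUnitary_rightRegular μ) ((cmDatum L 2 J).isStronglyContinuous_rightRegular_holds μ) (Subgroup.inclusion (inf_le_left : UnitaryGroup.arch (↥(maximalRealSubfield L)) L (IsCMField.complexConj L) 2 J ⊓ unitaryGroupOfForm (conjMixed (↥(maximalRealSubfield L)) L (IsCMField.complexConj L)) 1 ≤ UnitaryGroup.arch (↥(maximalRealSubfield L)) L (IsCMField.complexConj L) 2 J)) (continuous_induced_rng.2 continuous_subtype_val) μK χ (hχmul_of_kType χ τ hχτ) _ x hPx k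

/-- **`hD5` WITH ONLY THE MODEL LETTERS, GENERAL `χ`** (p23's ★ `hD5_letterFree_two` is the `χ ≡ 1` case): per block ★ `lpModel_blockProj_eq_zero_letterFree_two` (K2E2-p12; `hTB` ★ inside) on
`snd ∘ U b`, for a multiplicative unitary `χ` (`hχmul ∕ hχone ∕ hχinv`): `(U b (P w)).2 = 0` for every irreducible closed `W`, `w ∈ W`. [cite: MoeglinWaldspurger1995, IV.3.12, VI.2] -/
theorem hD5_letterFree_two_of_letters [ENNReal.HolderTriple ∞ 2 2]
    (hJc : J.map (IsCMField.complexConj L : L → L) = J) (hJ2 : J * J = 1)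
    (hJw : ∀ w : {w : InfinitePlace L // IsComplex w}, J.map w.1.embedding = !![(0 : ℂ), 1; 1, 0])
    (hχmul : ∀ k l, χ (k * l) = χ k * χ l) (hχone : χ 1 = 1) (hχinv : ∀ k, conj (χ k⁻¹) = χ k)
    (K' : Subgroup (finAdelic (↥(maximalRealSubfield L)) L (IsCMField.complexConj L) 2 J)) (he0 : ∀ x, x ∉ K' → e x = 0) (he1 : ∫ x, e x ∂νf = 1)
    (heK : ∀ k ∈ K', ∀ x, e (k * x) = e x) (hestar : ∀ x, mulStar (⇑e) x = e x)
    (P : (cmDatum L 2 J).L2 μ →L[ℂ] (cmDatum L 2 J).L2 μ) (hPdef : P = ((((cmDatum L 2 J).rightRegular μ).restrict ((archToAdelic (↥(maximalRealSubfield L)) L (IsCMField.complexConj L) 2 J).comp (Subgroup.inclusion (inf_le_left : UnitaryGroup.arch (↥(maximalRealSubfield L)) L (IsCMField.complexConj L) 2 J ⊓ unitaryGroupOfForm (conjMixed (↥(maximalRealSubfield L)) L (IsCMField.complexConj L)) 1 ≤ UnitaryGroup.arch (↥(maximalRealSubfield L)) L (IsCMField.complexConj L) 2 J)))).integratedOperator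 (((cmDatum L 2 J).isUnitary_rightRegular μ).restrict _)
          (((cmDatum L 2 J).isStronglyContinuous_rightRegular_holds μ).restrict _ ((continuous_archToAdelic (↥(maximalRealSubfield L)) L (IsCMField.complexConj L) 2 J).comp (continuous_induced_rng.2 continuous_subtype_val))) μK χ ∘L
        (((cmDatum L 2 J).rightRegular μ).restrict (finAdelicToAdelic (↥(maximalRealSubfield L)) L (IsCMField.complexConj L) 2 J)).integratedOperator (((cmDatum L 2 J).isUnitary_rightRegular μ).restrict _) (((cmDatum L 2 J).isStronglyContinuous_rightRegular_holds μ).restrict _ (continuous_finAdelicToAdelic (↥(maximalRealSubfield L)) L (IsCMField.complexConj L) 2 J)) νf e))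
    (𝔓 : (cmDatum L 2 J).ParabolicUnipotentData)
    {S : Type*} (gen : S → Set ((cmDatum L 2 J).L2 μ))
    {A : S → Type*} [∀ b, AddCommGroup (A b)] [∀ b, Module ℂ (A b)] [∀ b, FiniteDimensional ℂ (A b)]
    {Ω : S → Type*} {mΩ : ∀ b, MeasurableSpace (Ω b)} (m : ∀ b, Measure (Ω b)) {E : S → Type*} [∀ b, NormedAddCommGroup (E b)] [∀ b, NormedSpace ℂ (E b)]
    (V : ∀ b, (cmDatum L 2 J).L2 μ →ₗ[ℂ] (A b × Lp (E b) 2 (m b)))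
    (Jb : S → Type*) [∀ b, Countable (Jb b)]
    (h : ∀ b, Jb b → C_c(UnitaryGroup.arch (↥(maximalRealSubfield L)) L (IsCMField.complexConj L) 2 J, ℂ))
    (hhl : ∀ b (j : Jb b) (k : ↥(UnitaryGroup.arch (↥(maximalRealSubfield L)) L (IsCMField.complexConj L) 2 J ⊓ unitaryGroupOfForm (conjMixed (↥(maximalRealSubfield L)) L (IsCMField.complexConj L)) 1)) (x : UnitaryGroup.arch (↥(maximalRealSubfield L)) L (IsCMField.complexConj L) 2 J), h b j ((Subgroup.inclusion (inf_le_left : UnitaryGroup.arch (↥(maximalRealSubfield L)) L (IsCMField.complexConj L) 2 J ⊓ unitaryGroupOfForm (conjMixed (↥(maximalRealSubfield L)) L (IsCMField.complexConj L)) 1 ≤ UnitaryGroup.arch (↥(maximalRealSubfield L)) L (IsCMField.complexConj L) 2 J)) k * x) = χ k * h b j x)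
    (hhr : ∀ b (j : Jb b) (k : ↥(UnitaryGroup.arch (↥(maximalRealSubfield L)) L (IsCMField.complexConj L) 2 J ⊓ unitaryGroupOfForm (conjMixed (↥(maximalRealSubfield L)) L (IsCMField.complexConj L)) 1)) (x : UnitaryGroup.arch (↥(maximalRealSubfield L)) L (IsCMField.complexConj L) 2 J), h b j (x * (Subgroup.inclusion (inf_le_left : UnitaryGroup.arch (↥(maximalRealSubfield L)) L (IsCMField.complexConj L) 2 J ⊓ unitaryGroupOfForm (conjMixed (↥(maximalRealSubfield L)) L (IsCMField.complexConj L)) 1 ≤ UnitaryGroup.arch (↥(maximalRealSubfield L)) L (IsCMField.complexConj L) 2 J)) k) = χ k * h b j x)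
    (s : ∀ b, Jb b → Ω b → ℂ) (hs : ∀ b j, MemLp (s b j) ∞ (m b))
    (hU : ∀ b j, ∀ v ∈ LinearMap.eqLocus (P : (cmDatum L 2 J).L2 μ →ₗ[ℂ] (cmDatum L 2 J).L2 μ) LinearMap.id,
      ((V b ∘ₗ (((Submodule.span ℂ (gen b)).topologicalClosure).starProjection : (cmDatum L 2 J).L2 μ →L[ℂ] (cmDatum L 2 J).L2 μ).toLinearMap) (((((cmDatum L 2 J).rightRegular μ).restrict (archToAdelic (↥(maximalRealSubfield L)) L (IsCMField.complexConj L) 2 J)).integratedOperator (((cmDatum L 2 J).isUnitary_rightRegular μ).restrict _) (((cmDatum L 2 J).isStronglyContinuous_rightRegular_holds μ).restrict _ (continuous_archToAdelic (↥(maximalRealSubfield L)) L (IsCMField.complexConj L) 2 J)) νinf (h b j) ∘L (((cmDatum L 2 J).rightRegular μ).restrict (finAdelicToAdelic (↥(maximalRealSubfield L)) L (IsCMField.complexConj L) 2 J)).integratedOperator (((cmDatum L 2 J).isUnitary_rightRegular μ).restrict _) (((cmDatum L 2 J).isStronglyContinuous_rightRegular_holds μ).restrict _ (continuous_finAdelicToAdelic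 (↥(maximalRealSubfield L)) L (IsCMField.complexConj L) 2 J)) νf e) v)).2 = ((hs b j).toLp (s b j) • ((V b ∘ₗ (((Submodule.span ℂ (gen b)).topologicalClosure).starProjection : (cmDatum L 2 J).L2 μ →L[ℂ] (cmDatum L 2 J).L2 μ).toLinearMap) v).2 : Lp (E b) 2 (m b)))
    (hline : ∀ b (c : Jb b → ℂ), m b {x | ∀ j, s b j x = c j} = 0) :
    ∀ W : ClosedSubrep (((cmDatum L 2 J).rightRegular μ)), W.toContRep.IsTopIrreducible → W ≤ residualSubspace (cmDatum L 2 J) μ 𝔓 → ∀ w ∈ W, ∀ b, ((V b ∘ₗ (((Submodule.span ℂ (gen b)).topologicalClosure).starProjection : (cmDatum L 2 J).L2 μ →L[ℂ] (cmDatum L 2 J).L2 μ).toLinearMap) (P w)).2 = 0 := by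
  intro W hW _ w hw b
  exact lpModel_blockProj_eq_zero_letterFree_two J ((cmDatum L 2 J).rightRegular μ) ((cmDatum L 2 J).isUnitary_rightRegular μ) ((cmDatum L 2 J).isStronglyContinuous_rightRegular_holds μ) νinf νf μK χ e hJc hJ2 hJw hχmul hχone hχinv
    K' he0 he1 heK hestar P hPdef W hW (h b) (hhl b) (hhr b) ((LinearMap.snd ℂ (A b) (Lp (E b) 2 (m b))).comp (V b ∘ₗ (((Submodule.span ℂ (gen b)).topologicalClosure).starProjection : (cmDatum L 2 J).L2 μ →L[ℂ] (cmDatum L 2 J).L2 μ).toLinearMap)) (s b) (hs b)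
    (fun j v hv => hU b j v hv) (hline b) hw

end CM

/-! ## §4 The `τ = 1` currency bridges (for the witness of part 2) -/

section Bridges

variable {L : Type} [Field L] [NumberField L] [IsCMField L] (J : Matrix (Fin 2) (Fin 2) L)
  (μ : Measure (cmDatum L 2 J).automorphicQuotient) [(cmDatum L 2 J).IsAutomorphicMeasure μ]

/-- **`Eis_1 ≤ Eis(Kad)`**: a vector of `(L²_cusp)ᗮ` that is `K′`-invariant under `ι_f` and `K_∞`-invariant under `ι_∞ ∘ incl` (the `τ = 1` eigen-clause) is invariant under every adelic level
`Kad ≤ closure (ι_∞ incl (K_∞) ∪ ι_f(K′))` — closure induction on the stabiliser of `x` (as in ★ p860758 `hEisdef_of_trivial_kType`). [cite: BorelJacquet1979, §4.1] -/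
theorem eisOne_split_le_eis (K' : Subgroup (finAdelic (↥(maximalRealSubfield L)) L (IsCMField.complexConj L) 2 J)) (𝔓 : (cmDatum L 2 J).ParabolicUnipotentData)
    (Kad : Subgroup (cmDatum L 2 J).Adelic) (hKad : Kad ≤ Subgroup.closure (Set.range (fun k : ↥(UnitaryGroup.arch (↥(maximalRealSubfield L)) L (IsCMField.complexConj L) 2 J ⊓ unitaryGroupOfForm (conjMixed (↥(maximalRealSubfield L)) L (IsCMField.complexConj L)) 1) => (archToAdelic (↥(maximalRealSubfield L)) L (IsCMField.complexConj L) 2 J) ((Subgroup.inclusion (inf_le_left : UnitaryGroup.arch (↥(maximalRealSubfield L)) L (IsCMField.complexConj L) 2 J ⊓ unitaryGroupOfForm (conjMixed (↥(maximalRealSubfield L)) L (IsCMField.complexConj L)) 1 ≤ UnitaryGroup.arch (↥(maximalRealSubfield L)) L (IsCMField.complexConj L) 2 J)) k)) ∪ (finAdelicToAdelic (↥(maximalRealSubfield L)) L (IsCMField.complexConj L) 2 J) '' (K' : Set (finAdelic (↥(maximalRealSubfield L)) L (IsCMField.complexConj L) 2 J)))) :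
    (((cmDatum L 2 J).cuspidalSubspace μ 𝔓).toSubmoduleᗮ ⊓ (((cmDatum L 2 J).rightRegular μ).restrict ((finAdelicToAdelic (↥(maximalRealSubfield L)) L (IsCMField.complexConj L) 2 J).comp K'.subtype)).invariants ⊓ ⨅ k : ↥(UnitaryGroup.arch (↥(maximalRealSubfield L)) L (IsCMField.complexConj L) 2 J ⊓ unitaryGroupOfForm (conjMixed (↥(maximalRealSubfield L)) L (IsCMField.complexConj L)) 1), Module.End.eigenspace ((((cmDatum L 2 J).rightRegular μ) (((archToAdelic (↥(maximalRealSubfield L)) L (IsCMField.complexConj L) 2 J).comp (Subgroup.inclusion (inf_le_left : UnitaryGroup.arch (↥(maximalRealSubfield L)) L (IsCMField.complexConj L) 2 J ⊓ unitaryGroupOfForm (conjMixed (↥(maximalRealSubfield L)) L (IsCMField.complexConj L)) 1 ≤ UnitaryGroup.arch (↥(maximalRealSubfield L)) L (IsCMField.complexConj L) 2 J))) k) : (cmDatum L 2 J).L2 μ →L[ℂ] (cmDatum L 2 J).L2 μ) : (cmDatum L 2 J).L2 μ →ₗ[ℂ] (cmDatum L 2 J).L2 μ) ((1 : ↥(UnitaryGroup.arch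 (↥(maximalRealSubfield L)) L (IsCMField.complexConj L) 2 J ⊓ unitaryGroupOfForm (conjMixed (↥(maximalRealSubfield L)) L (IsCMField.complexConj L)) 1) →* ℂ) k)) ≤
      ((cmDatum L 2 J).cuspidalSubspace μ 𝔓).toSubmoduleᗮ ⊓ (((cmDatum L 2 J).rightRegular μ).restrict Kad.subtype).invariants := by
  intro x hx
  obtain ⟨hx₁, ha⟩ := Submodule.mem_inf.1 hx
  obtain ⟨hxo, hf⟩ := Submodule.mem_inf.1 hx₁
  refine Submodule.mem_inf.2 ⟨hxo, ?_⟩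
  rw [ContRepresentation.mem_invariants]
  have hgen : ∀ g ∈ (Set.range (fun k : ↥(UnitaryGroup.arch (↥(maximalRealSubfield L)) L (IsCMField.complexConj L) 2 J ⊓ unitaryGroupOfForm (conjMixed (↥(maximalRealSubfield L)) L (IsCMField.complexConj L)) 1) => (archToAdelic (↥(maximalRealSubfield L)) L (IsCMField.complexConj L) 2 J) ((Subgroup.inclusion (inf_le_left : UnitaryGroup.arch (↥(maximalRealSubfield L)) L (IsCMField.complexConj L) 2 J ⊓ unitaryGroupOfForm (conjMixed (↥(maximalRealSubfield L)) L (IsCMField.complexConj L)) 1 ≤ UnitaryGroup.arch (↥(maximalRealSubfield L)) L (IsCMField.complexConj L) 2 J)) k)) ∪ (finAdelicToAdelic (↥(maximalRealSubfield L)) L (IsCMField.complexConj L) 2 J) '' (K' : Set (finAdelic (↥(maximalRealSubfield L)) L (IsCMField.complexConj L) 2 J))), ((cmDatum L 2 J).rightRegular μ) g x = x := by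
    rintro g (⟨k, rfl⟩ | ⟨kf, hkf, rfl⟩)
    · have h := (Submodule.mem_iInf _).1 ha k
      rw [Module.End.mem_eigenspace_iff, MonoidHom.one_apply, one_smul] at h
      exact h
    · exact (ContRepresentation.mem_invariants x).1 hf ⟨kf, hkf⟩
  have hcl : ∀ g ∈ Subgroup.closure (Set.range (fun k : ↥(UnitaryGroup.arch (↥(maximalRealSubfield L)) L (IsCMField.complexConj L) 2 J ⊓ unitaryGroupOfForm (conjMixed (↥(maximalRealSubfield L)) L (IsCMField.complexConj L)) 1) => (archToAdelic (↥(maximalRealSubfield L)) L (IsCMField.complexConj L) 2 J) ((Subgroup.inclusion (inf_le_left : UnitaryGroup.arch (↥(maximalRealSubfield L)) L (IsCMField.complexConj L) 2 J ⊓ unitaryGroupOfForm (conjMixed (↥(maximalRealSubfield L)) L (IsCMField.complexConj L)) 1 ≤ UnitaryGroup.arch (↥(maximalRealSubfield L)) L (IsCMField.complexConj L) 2 J)) k)) ∪ (finAdelicToAdelic (↥(maximalRealSubfield L)) L (IsCMField.complexConj L) 2 J) '' (K' : Set (finAdelic (↥(maximalRealSubfield L)) L (IsCMField.complexConj L) 2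 J))), ((cmDatum L 2 J).rightRegular μ) g x = x := by
    intro g hg
    refine Subgroup.closure_induction (p := fun g _ => ((cmDatum L 2 J).rightRegular μ) g x = x) (fun g hg' => hgen g hg') ?_ ?_ ?_ hg
    · rw [map_one]; rfl
    · intro a b _ _ ha hb
      rw [map_mul]
      change ((cmDatum L 2 J).rightRegular μ) a (((cmDatum L 2 J).rightRegular μ) b x) = x
      rw [hb, ha]
    · intro a _ ha
      have h := congrArg (((cmDatum L 2 J).rightRegular μ) a⁻¹) ha
      change (((cmDatum L 2 J).rightRegular μ) a⁻¹ * ((cmDatum L 2 J).rightRegular μ) a) x = ((cmDatum L 2 J).rightRegular μ) a⁻¹ x at h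
      rw [← map_mul, inv_mul_cancel, map_one] at h
      exact h.symm
  intro k
  exact hcl _ (hKad k.2)

/-- **`(R ∘ ι_∞ incl)-invariants ≤ ⨅_k eigenspace (R (ι_∞ incl k)) 1`** (the `τ = 1` conclusion currency). [folklore] -/
theorem invariants_le_iInf_eigenspace_one :
    (((cmDatum L 2 J).rightRegular μ).restrict ((archToAdelic (↥(maximalRealSubfield L)) L (IsCMField.complexConj L) 2 J).comp (Subgroup.inclusion (inf_le_left : UnitaryGroup.arch (↥(maximalRealSubfield L)) L (IsCMField.complexConj L) 2 J ⊓ unitaryGroupOfForm (conjMixed (↥(maximalRealSubfield L)) L (IsCMField.complexConj L)) 1 ≤ UnitaryGroup.arch (↥(maximalRealSubfield L)) L (IsCMField.complexConj L) 2 J)))).invariants ≤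
      ⨅ k : ↥(UnitaryGroup.arch (↥(maximalRealSubfield L)) L (IsCMField.complexConj L) 2 J ⊓ unitaryGroupOfForm (conjMixed (↥(maximalRealSubfield L)) L (IsCMField.complexConj L)) 1), Module.End.eigenspace ((((cmDatum L 2 J).rightRegular μ) (((archToAdelic (↥(maximalRealSubfield L)) L (IsCMField.complexConj L) 2 J).comp (Subgroup.inclusion (inf_le_left : UnitaryGroup.arch (↥(maximalRealSubfield L)) L (IsCMField.complexConj L) 2 J ⊓ unitaryGroupOfForm (conjMixed (↥(maximalRealSubfield L)) L (IsCMField.complexConj L)) 1 ≤ UnitaryGroup.arch (↥(maximalRealSubfield L)) L (IsCMField.complexConj L) 2 J))) k) : (cmDatum L 2 J).L2 μ →L[ℂ] (cmDatum L 2 J).L2 μ) : (cmDatum L 2 J).L2 μ →ₗ[ℂ] (cmDatum L 2 J).L2 μ) ((1 : ↥(UnitaryGroup.arch (↥(maximalRealSubfield L)) L (IsCMField.complexConj L) 2 J ⊓ unitaryGroupOfForm (conjMixed (↥(maximalRealSubfield L)) L (IsCMField.complexConj L)) 1) →* ℂ) k) := by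
  intro x hx
  rw [Submodule.mem_iInf]
  intro k
  rw [Module.End.mem_eigenspace_iff, MonoidHom.one_apply, one_smul]
  exact (ContRepresentation.mem_invariants x).1 hx k

end Bridges

end Summit.HodgeConjecture.HodgeConjecture.Cruxes.H413.K2E1ResidualKTypeAtomLettersCMTwo

end
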